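import Summits.KontsevichZagierPeriods.KontsevichZagierPeriods.Theorems.SoloInformedEquidimRelations
import Literature.NumberTheory.Transcendental.KZUnfolding
import HarnessLib
import HarnessLib.Audit

/-!
# SoloInformed — junk, congruence and finite domain additivity modulo `relations₁₂` (Newton–Leibniz elimination, file 2a)

Solo programme `solo-KontsevichZagierPeriods-informed`, session s245 (K-NF, `paper/nl-elimination.md`
§7.2: the first lemmas of FILES 2–4, the kernel proof of THEOREM NF).

The bookkeeping half of the proof of `SoloInformedNLElimination` happens inside the equidimensional
relations `relations₁₂ = soloInformedEquidimRelations` (file 583): null domains and zero integrands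
are junk, signs live in the integrand, representations with the same domain and integrands agreeing
on it are congruent, and a representation splits along any finite cover of its domain by
`ℚ`-semialgebraic pieces with pairwise null overlaps.  The first three are
`Literature/NumberTheory/Transcendental/KZUnfolding.lean`'s "junk is level" lemmas transported along
`KZ.levelRel ≤ relations₁₂` (`KZ.permRel ⊆ changeOfVariablesRel`); the last is domain additivity
(1a) iterated along a `Finset`.

* `soloInformed_levelRel_le_equidimRelations : KZ.levelRel ≤ relations₁₂`;
* `soloInformed_of_mem_equidimRelations_of_volume_eq_zero`, `…_of_eqOn_zero`,
  `soloInformed_of_add_of_neg_mem_equidimRelations`, `soloInformed_of_sub_of_mem_equidimRelations_of_eqOn`;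
* `soloInformedRestrict r hs hsub` (restriction of a representation to a semialgebraic subset of its
  domain), `soloInformed_of_sub_of_restrict_sub_of_restrict_mem` (two pieces),
  `soloInformed_of_sub_of_restrict_mem_of_volume_diff_eq_zero` (drop a null remainder);
* `soloInformed_of_sub_sum_of_mem_equidimRelations`: **finite domain additivity** —
  `[r] − ∑_{i ∈ S} [ρ i] ∈ relations₁₂` for a finite family covering `r.domain` with pairwise null
  overlaps and integrands agreeing with `r`'s.

References: M. Kontsevich, D. Zagier, *Periods* (2001), §1.2, rule 1); this work (THEOREM NF,
`paper/nl-elimination.md` §7.2).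
-/

noncomputable section

open scoped BigOperators

namespace Summit.KontsevichZagierPeriods.KontsevichZagierPeriods.Theorems

open Set MeasureTheory
open Literature.ModelTheory.ExponentialFields
open Literature.NumberTheory.Transcendental Literature.NumberTheory.Transcendental.KZ

variable {n : ℕ}

/-! ### `levelRel ≤ relations₁₂` and junk -/

/-- Coordinate permutations are equidimensional relations. [Kontsevich–Zagier 2001, §1.2, rule 2)] -/
theorem soloInformed_permRel_subset_equidimRelations :
    permRel ⊆ (soloInformedEquidimRelations : Set FormalRep) := fun _ hc =>
  soloInformed_changeOfVariablesRel_subset_equidimRelations (permRel_subset_changeOfVariablesRel hc)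

/-- **`KZ.levelRel ≤ relations₁₂`**: the level moves (1a), (1b), coordinate permutations are
equidimensional moves. [Kontsevich–Zagier 2001, §1.2, rules 1)–2)] -/
theorem soloInformed_levelRel_le_equidimRelations : levelRel ≤ soloInformedEquidimRelations := by
  rw [levelRel_def, AddSubgroup.closure_le]
  rintro c ((hc | hc) | hc)
  · exact soloInformed_domainAddRel_subset_equidimRelations hc
  · exact soloInformed_integrandAddRel_subset_equidimRelations hc
  · exact soloInformed_permRel_subset_equidimRelations hc

/-- **Null domains are junk** in `relations₁₂`. [Kontsevich–Zagier 2001, §1.2, rule 1)] -/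
theorem soloInformed_of_mem_equidimRelations_of_volume_eq_zero (r : IntegralRep n)
    (h : volume r.domain = 0) : of r ∈ soloInformedEquidimRelations :=
  soloInformed_levelRel_le_equidimRelations (of_mem_levelRel_of_volume_eq_zero r h)

/-- **Zero integrands are junk** in `relations₁₂`. [Kontsevich–Zagier 2001, §1.2, rule 1)] -/
theorem soloInformed_of_mem_equidimRelations_of_eqOn_zero (r : IntegralRep n)
    (h : EqOn r.integrand 0 r.domain) : of r ∈ soloInformedEquidimRelations :=
  soloInformed_levelRel_le_equidimRelations (of_mem_levelRel_of_eqOn_zero r h)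

/-- **Free cancellation** in `relations₁₂`: `[σ, f] + [σ, −f] ∈ relations₁₂`.
[Kontsevich–Zagier 2001, §1.2, rule 1)] -/
theorem soloInformed_of_add_of_neg_mem_equidimRelations (r : IntegralRep n) :
    of r + of r.neg ∈ soloInformedEquidimRelations :=
  soloInformed_levelRel_le_equidimRelations (of_add_of_neg_mem_levelRel r)

/-- `[σ, −f] ≡ −[σ, f] (mod relations₁₂)`. [Kontsevich–Zagier 2001, §1.2, rule 1)] -/
theorem soloInformed_of_neg_add_of_mem_equidimRelations (r : IntegralRep n) :
    of r.neg - (-of r) ∈ soloInformedEquidimRelations := by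
  rw [sub_neg_eq_add, add_comm]
  exact soloInformed_of_add_of_neg_mem_equidimRelations r

/-- **Congruence** in `relations₁₂`: same domain and integrands agreeing on it ⇒
`[r] − [r'] ∈ relations₁₂` (integrand additivity with a zero representation).
[Kontsevich–Zagier 2001, §1.2, rule 1)] -/
theorem soloInformed_of_sub_of_mem_equidimRelations_of_eqOn {r r' : IntegralRep n}
    (hd : r'.domain = r.domain) (h : EqOn r.integrand r'.integrand r.domain) :
    of r - of r' ∈ soloInformedEquidimRelations := by
  -- the zero representation on `r.domain`
  let z : IntegralRep n :=
    { domain := r.domain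
      integrand := 0
      isSemialgebraic_domain := r.isSemialgebraic_domain
      isSemialgebraicFunOn_integrand :=
        (isSemialgebraicFunOn_aeval r.isSemialgebraic_domain 0).congr fun x _ => by simp
      integrableOn := integrableOn_zero }
  have h1 : of r - of r' - of z ∈ soloInformedEquidimRelations :=
    soloInformed_integrandAddRel_subset_equidimRelations
      ⟨n, r, r', z, hd, rfl, fun x hx => by
        show r.integrand x = (r'.integrand + 0) x
        rw [add_zero]; exact h hx, rfl⟩
  have h2 : of z ∈ soloInformedEquidimRelations :=
    soloInformed_of_mem_equidimRelations_of_eqOn_zero z fun _ _ => rfl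
  have h3 := soloInformedEquidimRelations.add_mem h1 h2
  rwa [sub_add_cancel] at h3

/-! ### Restriction of a representation and domain additivity -/

/-- **Restriction** of a representation to a `ℚ`-semialgebraic subset of its domain (same
integrand). [Kontsevich–Zagier 2001, §1.2, rule 1)] -/
def soloInformedRestrict (r : IntegralRep n) {s : Set (Fin n → ℝ)} (hs : IsSemialgebraic ℚ s)
    (hsub : s ⊆ r.domain) : IntegralRep n where
  domain := s
  integrand := r.integrand
  isSemialgebraic_domain := hs
  isSemialgebraicFunOn_integrand := r.isSemialgebraicFunOn_integrand.mono hsub hs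
  integrableOn := r.integrableOn.mono_set hsub

/-- The domain of a restriction. -/
@[simp] theorem soloInformed_restrict_domain (r : IntegralRep n) {s : Set (Fin n → ℝ)}
    (hs : IsSemialgebraic ℚ s) (hsub : s ⊆ r.domain) : (soloInformedRestrict r hs hsub).domain = s :=
  rfl

/-- The integrand of a restriction. -/
@[simp] theorem soloInformed_restrict_integrand (r : IntegralRep n) {s : Set (Fin n → ℝ)}
    (hs : IsSemialgebraic ℚ s) (hsub : s ⊆ r.domain) :
    (soloInformedRestrict r hs hsub).integrand = r.integrand :=
  rfl

/-- The value of a restriction is the integral over the piece. -/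
theorem soloInformed_value_restrict (r : IntegralRep n) {s : Set (Fin n → ℝ)}
    (hs : IsSemialgebraic ℚ s) (hsub : s ⊆ r.domain) :
    (soloInformedRestrict r hs hsub).value = ∫ x in s, r.integrand x :=
  rfl

/-- **Two-piece domain additivity** in `relations₁₂`: `σ = s ∪ t`, `s ∩ t` null ⇒
`[r] − [r|ₛ] − [r|ₜ] ∈ relations₁₂`. [Kontsevich–Zagier 2001, §1.2, rule 1)] -/
theorem soloInformed_of_sub_of_restrict_sub_of_restrict_mem (r : IntegralRep n)
    {s t : Set (Fin n → ℝ)} (hs : IsSemialgebraic ℚ s) (ht : IsSemialgebraic ℚ t)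
    (hsub : s ⊆ r.domain) (htsub : t ⊆ r.domain) (hcover : r.domain = s ∪ t)
    (hnull : volume (s ∩ t) = 0) :
    of r - of (soloInformedRestrict r hs hsub) - of (soloInformedRestrict r ht htsub) ∈
      soloInformedEquidimRelations :=
  soloInformed_domainAddRel_subset_equidimRelations
    ⟨n, r, soloInformedRestrict r hs hsub, soloInformedRestrict r ht htsub, hcover, hnull,
      fun _ _ => rfl, fun _ _ => rfl, rfl⟩

/-- **Dropping a null remainder**: if `s ⊆ σ` is `ℚ`-semialgebraic and `σ \ s` is null then
`[r] − [r|ₛ] ∈ relations₁₂`. [Kontsevich–Zagier 2001, §1.2, rule 1)] -/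
theorem soloInformed_of_sub_of_restrict_mem_of_volume_diff_eq_zero (r : IntegralRep n)
    {s : Set (Fin n → ℝ)} (hs : IsSemialgebraic ℚ s) (hsub : s ⊆ r.domain)
    (hnull : volume (r.domain \ s) = 0) :
    of r - of (soloInformedRestrict r hs hsub) ∈ soloInformedEquidimRelations := by
  have ht : IsSemialgebraic ℚ (r.domain \ s) := r.isSemialgebraic_domain.diff hs
  have h1 := soloInformed_of_sub_of_restrict_sub_of_restrict_mem r hs ht hsub Set.sdiff_subset
    (by rw [Set.union_sdiff_cancel hsub]) (by rw [Set.inter_sdiff_self, measure_empty])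
  have h2 : of (soloInformedRestrict r ht Set.sdiff_subset) ∈ soloInformedEquidimRelations :=
    soloInformed_of_mem_equidimRelations_of_volume_eq_zero _ hnull
  have h3 := soloInformedEquidimRelations.add_mem h1 h2
  rwa [sub_add_cancel] at h3

/-- **Finite domain additivity** in `relations₁₂`: if `r.domain = ⋃_{i ∈ S} (ρ i).domain` with
pairwise null overlaps and the integrands of the `ρ i` agree with `r`'s on their domains, then
`[r] − ∑_{i ∈ S} [ρ i] ∈ relations₁₂` (rule (1a) iterated). [Kontsevich–Zagier 2001, §1.2, rule 1)] -/
theorem soloInformed_of_sub_sum_of_mem_equidimRelations {ι : Type*} (S : Finset ι)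
    (ρ : ι → IntegralRep n) (r : IntegralRep n)
    (hcover : r.domain = ⋃ i ∈ S, (ρ i).domain)
    (hint : ∀ i ∈ S, EqOn r.integrand (ρ i).integrand (ρ i).domain)
    (hnull : ∀ i ∈ S, ∀ j ∈ S, i ≠ j → volume ((ρ i).domain ∩ (ρ j).domain) = 0) :
    of r - ∑ i ∈ S, of (ρ i) ∈ soloInformedEquidimRelations := by
  classical
  induction S using Finset.induction_on generalizing r with
  | empty =>
    rw [Finset.sum_empty, sub_zero]
    refine soloInformed_of_mem_equidimRelations_of_volume_eq_zero r ?_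
    rw [hcover]; simp
  | insert a S ha ih =>
    -- the union of the remaining pieces
    set U : Set (Fin n → ℝ) := ⋃ i ∈ S, (ρ i).domain with hU
    have hUsa : IsSemialgebraic ℚ U :=
      IsSemialgebraic.biUnion S (fun i => (ρ i).domain) fun i _ => (ρ i).isSemialgebraic_domain
    have hcover' : r.domain = (ρ a).domain ∪ U := by rw [hcover, Finset.set_biUnion_insert]
    have hUsub : U ⊆ r.domain := by rw [hcover']; exact subset_union_right
    have hasub : (ρ a).domain ⊆ r.domain := by rw [hcover']; exact subset_union_left
    -- the overlap of the new piece with the rest is null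
    have hnull' : volume ((ρ a).domain ∩ U) = 0 := by
      rw [hU, inter_iUnion₂]
      refine (measure_biUnion_null_iff S.countable_toSet).2 fun i hi => ?_
      exact hnull a (Finset.mem_insert_self a S) i (Finset.mem_insert_of_mem hi)
        (fun h => ha (h ▸ hi))
    -- split `r` into the piece over `(ρ a).domain` and the restriction to `U`
    set rU : IntegralRep n := soloInformedRestrict r hUsa hUsub with hrU
    have h1 : of r - of (ρ a) - of rU ∈ soloInformedEquidimRelations :=
      soloInformed_domainAddRel_subset_equidimRelations
        ⟨n, r, ρ a, rU, hcover', hnull', hint a (Finset.mem_insert_self a S), fun _ _ => rfl, rfl⟩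
    -- induction hypothesis for the restriction
    have h2 : of rU - ∑ i ∈ S, of (ρ i) ∈ soloInformedEquidimRelations :=
      ih rU rfl (fun i hi => hint i (Finset.mem_insert_of_mem hi))
        (fun i hi j hj hij => hnull i (Finset.mem_insert_of_mem hi) j (Finset.mem_insert_of_mem hj) hij)
    rw [Finset.sum_insert ha]
    have e : of r - (of (ρ a) + ∑ i ∈ S, of (ρ i)) =
        (of r - of (ρ a) - of rU) + (of rU - ∑ i ∈ S, of (ρ i)) := by abel
    rw [e]
    exact soloInformedEquidimRelations.add_mem h1 h2

/-- **Finite domain additivity, value form**: under the same hypotheses the values add up.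
[Kontsevich–Zagier 2001, §1.2, rule 1)] -/
theorem soloInformed_value_eq_sum_value {ι : Type*} (S : Finset ι) (ρ : ι → IntegralRep n)
    (r : IntegralRep n) (hcover : r.domain = ⋃ i ∈ S, (ρ i).domain)
    (hint : ∀ i ∈ S, EqOn r.integrand (ρ i).integrand (ρ i).domain)
    (hnull : ∀ i ∈ S, ∀ j ∈ S, i ≠ j → volume ((ρ i).domain ∩ (ρ j).domain) = 0) :
    r.value = ∑ i ∈ S, (ρ i).value := by
  have h := relations_le_ker_eval_holds
    (soloInformed_equidimRelations_le_relations
      (soloInformed_of_sub_sum_of_mem_equidimRelations S ρ r hcover hint hnull))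
  rw [AddMonoidHom.mem_ker, map_sub, map_sum, sub_eq_zero, eval_of] at h
  simpa only [eval_of] using h

end Summit.KontsevichZagierPeriods.KontsevichZagierPeriods.Theorems
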